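import Summits.QuantumFields.YangMills.Theorems.FemtoCutoffLadderLocalWallCutBoundPair
import Summits.QuantumFields.YangMills.Theorems.FemtoCutoffLadderWalledSecondPos

/-!
# Route `FemtoCutoffLadder`, crux `LocalWallStep` (stmt-QuantumFields-26282): the two one-wall lower bounds ⟸ ONE-PLAQUETTE RARITY of
# near-optimal walled trial states — eigenfunction-free doors for BOTH halves of `stub_localWallComparisons`

Seat `leafhand-qf-femtocutoffladder-2` g0 (2026-08-30), `--supports stmt-QuantumFields-26282`.  With ✓`localWallStep_of_oneWallLowerBounds`
(p793595) the registered stub is (T) `t Q ≤ e^{a/L} t (Q ∪ {p₀})` and (S) `s Q ≤ e^{a/L} s (Q ∪ {p₀})`, `a = A/(β²N)`.  The walled problems have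
no eigenfunctions in the tree, so the parent crux's «cut an exact eigen(pair)» reductions do not apply.  This file closes that gap WITHOUT a walled
spectral theorem:

* §1 `exists_witness_gt`: an admissible trial function with Rayleigh quotient above any `m < t_P` (definition of `sSup`);
  ★ `exists_plane_of_compressedSecond` — the elementary «max–min ≥ min–max» direction: for ANY linear constraint `P` with `0 < s_P` and every
  `δ > 0` there is an `l2`-ORTHONORMAL admissible physical pair whose whole span has Rayleigh floor `s_P − δ`.  (Near-top `ψ̂₁`, then a near-optimal
  `ψ̂₂ ⊥ ψ̂₁` from the constraint `φ = ψ̂₁`; the cross term obeys `|⟨ψ̂₁,K_βψ̂₂⟩| ≤ √(ηt)` because `R ≤ t_P` on the span — the discriminant trick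
  at `τ = ±√(η/t)`.)
* §2 ★ `le_walledTop_insert_of_rarity`: if every admissible `f ∈ W Q` with `R(f) ≥ t Q − δ` carries at most the fraction `ε` of its mass on
  «`p₀` is κ-bad» (`ε < 1`, `λ₀ε ≤ tQ − δ`), then `(√(tQ − δ) − √(λ₀ε))² ≤ t (Q ∪ {p₀})` (witness + ✓`le_walledTop_of_cut` p794057 +
  ✓`wall_compl_indicator_eq_of_admissible`).
* §3 ★ `le_walledSecond_insert_of_planeRarity`: if every `l2`-orthonormal admissible pair in `W Q` with span floor `s Q − δ` carries, span-
  uniformly, at most the fraction `ε` on «`p₀` is κ-bad», then `(√(sQ − δ) − √(λ₀ε))² ≤ s (Q ∪ {p₀})` (§1 + ✓`le_walledSecond_of_cut_pair` +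
  sibling ✓`walledSecond_pos` p793746 for `0 < s Q`).
So `stub_localWallComparisons` ⟸ two explicit ONE-PLAQUETTE RARITY statements for near-optimal `Q`-walled trial states at rate
`√(λ₀ε) ≲ (1 − e^{−A/(2β²NL)})√(value)`, uniformly in `(Q, p₀)` — the physics of LINE g5-A («one more wall costs a `1/N` share of a stretched-
exponentially rare event»), now isolated as the ONLY open input.  HONEST FRAMING: fixed-lattice variational bookkeeping; no rarity bound is proved;
R2b1 is a RECORD rung — not infinite volume, not a mass gap, not Clay; no summit is proved by this file.  No definitions, no named facts, no `sorry`.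
[cite: ReedSimonIV1978, Thm. XIII.1]
-/

set_option autoImplicit false

noncomputable section

open MeasureTheory Filter Topology Real
open Literature.MathematicalPhysics.QuantumFieldTheory hiding SU2
open Literature.MathematicalPhysics.QuantumLattice

namespace Summit.QuantumFields.YangMills.Theorems.FemtoTransferGap.SFCompression

open OffTube

variable {L : ℕ} [NeZero L]

/-! ## §1 Near-optimal admissible witnesses and planes (no spectral theorem) -/

/-- **Near-optimal witness**: if `m < t_P` (and `t_P > 0`, so the Rayleigh set is non-empty) there is an admissible physical `ψ` with
`‖ψ‖² > 0` and `m‖ψ‖² ≤ ⟨ψ,K_βψ⟩`. [folklore] -/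
theorem exists_witness_gt {β : ℝ} (P : (GaugeConfig 3 L SU2 → ℝ) → Prop) (ht : 0 < sSup (rayleighSet su2Rep L β P)) {m : ℝ}
    (hm : m < sSup (rayleighSet su2Rep L β P)) :
    ∃ ψ : GaugeConfig 3 L SU2 → ℝ, IsPhys ψ ∧ P ψ ∧ 0 < l2 ψ ψ ∧ m * l2 ψ ψ ≤ qform su2Rep β ψ ψ := by
  have hne : (rayleighSet su2Rep L β P).Nonempty := by
    by_contra h
    rw [Set.not_nonempty_iff_eq_empty] at h
    rw [h, Real.sSup_empty] at ht
    exact lt_irrefl _ ht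
  obtain ⟨r, ⟨ψ, hψ, hP, hpos, rfl⟩, hlt⟩ := exists_lt_of_lt_csSup hne hm
  refine ⟨ψ, hψ, hP, hpos, ?_⟩
  rw [lt_div_iff₀ hpos] at hlt
  exact hlt.le

/-- Normalisation: for `‖ψ‖² = n > 0`, `‖(√n)⁻¹ ψ‖² = 1`. [folklore] -/
theorem l2_normalise {ψ : GaugeConfig 3 L SU2 → ℝ} (hn : 0 < l2 ψ ψ) :
    l2 ((Real.sqrt (l2 ψ ψ))⁻¹ • ψ) ((Real.sqrt (l2 ψ ψ))⁻¹ • ψ) = 1 := by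
  rw [l2_smul_left, UpStep.l2_smul_right', ← mul_assoc, ← mul_inv, Real.mul_self_sqrt hn.le, inv_mul_cancel₀ hn.ne']

/-- Normalisation keeps a Rayleigh floor: `m‖ψ‖² ≤ ⟨ψ,Kψ⟩ ⇒ m ≤ ⟨ψ̂,Kψ̂⟩` for `ψ̂ = (√‖ψ‖²)⁻¹ψ`. [folklore] -/
theorem le_qform_normalise (β : ℝ) {ψ : GaugeConfig 3 L SU2 → ℝ} (hψ : IsPhys ψ) (hn : 0 < l2 ψ ψ) {m : ℝ}
    (hm : m * l2 ψ ψ ≤ qform su2Rep β ψ ψ) :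
    m ≤ qform su2Rep β ((Real.sqrt (l2 ψ ψ))⁻¹ • ψ) ((Real.sqrt (l2 ψ ψ))⁻¹ • ψ) := by
  rw [qform_smul_left, qform_smul_right β _ hψ hψ, ← mul_assoc]
  have hc : (Real.sqrt (l2 ψ ψ))⁻¹ * (Real.sqrt (l2 ψ ψ))⁻¹ = (l2 ψ ψ)⁻¹ := by
    rw [← mul_inv, Real.mul_self_sqrt hn.le]
  rw [hc]
  rw [le_inv_mul_iff₀ hn]
  linarith

/-- `⟨af₁ + bf₂, K_β(af₁ + bf₂)⟩ = a²q₁₁ + 2ab q₁₂ + b²q₂₂`. [folklore] -/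
theorem qform_span_self (β : ℝ) {f₁ f₂ : GaugeConfig 3 L SU2 → ℝ} (h₁ : IsPhys f₁) (h₂ : IsPhys f₂) (a b : ℝ) :
    qform su2Rep β (a • f₁ + b • f₂) (a • f₁ + b • f₂) =
      a ^ 2 * qform su2Rep β f₁ f₁ + 2 * a * b * qform su2Rep β f₁ f₂ + b ^ 2 * qform su2Rep β f₂ f₂ := by
  rw [qform_add_add β (h₁.smul a) (h₂.smul b), qform_smul_left, qform_smul_right β a h₁ h₁, qform_smul_left,
    qform_smul_right β b h₁ h₂, qform_smul_left, qform_smul_right β b h₂ h₂]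
  ring

/-- ★ **Near-optimal admissible PLANE (elementary max–min ≥ min–max).**  Let the constraint `P` be closed under sums and real multiples and
let the compressed second value `s_P = inf_φ sSup (rayleighSet (P ∧ · ⊥ φ))` be positive (`β ≥ 0`).  Then for every `δ > 0` there are
`l2`-orthonormal admissible physical `ψ₁, ψ₂` whose span has Rayleigh floor `s_P − δ`:
`(s_P − δ)(a² + b²) ≤ ⟨aψ₁ + bψ₂, K_β(aψ₁ + bψ₂)⟩` for all real `a, b`. [cite: ReedSimonIV1978, Thm. XIII.1] -/
theorem exists_plane_of_compressedSecond {β : ℝ} (hβ : 0 ≤ β) {P : (GaugeConfig 3 L SU2 → ℝ) → Prop}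
    (hPadd : ∀ f g : GaugeConfig 3 L SU2 → ℝ, P f → P g → P (f + g))
    (hPsmul : ∀ (a : ℝ) (f : GaugeConfig 3 L SU2 → ℝ), P f → P (a • f))
    (hs : 0 < sInf {x : ℝ | ∃ φ : GaugeConfig 3 L SU2 → ℝ, IsPhys φ ∧
      x = sSup (rayleighSet su2Rep L β fun ψ => P ψ ∧ l2 ψ φ = 0)}) {δ : ℝ} (hδ : 0 < δ) :
    ∃ ψ₁ ψ₂ : GaugeConfig 3 L SU2 → ℝ, IsPhys ψ₁ ∧ IsPhys ψ₂ ∧ P ψ₁ ∧ P ψ₂ ∧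
      l2 ψ₁ ψ₁ = 1 ∧ l2 ψ₂ ψ₂ = 1 ∧ l2 ψ₁ ψ₂ = 0 ∧
      ∀ a b : ℝ, (sInf {x : ℝ | ∃ φ : GaugeConfig 3 L SU2 → ℝ, IsPhys φ ∧
        x = sSup (rayleighSet su2Rep L β fun ψ => P ψ ∧ l2 ψ φ = 0)} - δ) * (a ^ 2 + b ^ 2) ≤
        qform su2Rep β (a • ψ₁ + b • ψ₂) (a • ψ₁ + b • ψ₂) := by
  set s : ℝ := sInf {x : ℝ | ∃ φ : GaugeConfig 3 L SU2 → ℝ, IsPhys φ ∧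
      x = sSup (rayleighSet su2Rep L β fun ψ => P ψ ∧ l2 ψ φ = 0)} with hsdef
  set t : ℝ := sSup (rayleighSet su2Rep L β P) with htdef
  have hst : s ≤ t :=
    (csInf_le (compressedSecondSet_bddBelow hβ P) ⟨fun _ => 1, isPhys_const 1, rfl⟩).trans
      (sSup_rayleighSet_mono hβ fun ψ hψ => hψ.1)
  have ht : 0 < t := lt_of_lt_of_le hs hst
  -- the auxiliary precision `η`
  set η : ℝ := min (δ / 2) (δ ^ 2 / (4 * t)) with hηdef
  have hη : 0 < η := lt_min (by linarith) (by positivity)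
  have hηδ : η ≤ δ / 2 := min_le_left _ _
  have hηt : η * t ≤ δ ^ 2 / 4 := by
    have h := min_le_right (δ / 2) (δ ^ 2 / (4 * t))
    rw [← hηdef] at h
    calc η * t ≤ δ ^ 2 / (4 * t) * t := mul_le_mul_of_nonneg_right h ht.le
      _ = δ ^ 2 / 4 := by field_simp
  -- `ψ̂₁`: near-top, normalised
  obtain ⟨ψ₁, h₁, hP₁, hn₁, hR₁⟩ := exists_witness_gt P ht (show t - η < t by linarith)
  set ψ₁' : GaugeConfig 3 L SU2 → ℝ := (Real.sqrt (l2 ψ₁ ψ₁))⁻¹ • ψ₁ with hψ₁'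
  have h₁' : IsPhys ψ₁' := h₁.smul _
  have hP₁' : P ψ₁' := hPsmul _ _ hP₁
  have hn₁' : l2 ψ₁' ψ₁' = 1 := l2_normalise hn₁
  have hq₁ : t - η ≤ qform su2Rep β ψ₁' ψ₁' := le_qform_normalise β h₁ hn₁ hR₁
  -- `ψ̂₂`: near-optimal under the constraint `⊥ ψ̂₁`, normalised
  set S₂ : Set ℝ := rayleighSet su2Rep L β fun ψ => P ψ ∧ l2 ψ ψ₁' = 0 with hS₂
  have hsS₂ : s ≤ sSup S₂ :=
    csInf_le (compressedSecondSet_bddBelow hβ P) ⟨ψ₁', h₁', rfl⟩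
  have hS₂pos : 0 < sSup S₂ := lt_of_lt_of_le hs hsS₂
  obtain ⟨ψ₂, h₂, ⟨hP₂, horth₂⟩, hn₂, hR₂⟩ :=
    exists_witness_gt (fun ψ => P ψ ∧ l2 ψ ψ₁' = 0) hS₂pos (show s - η < sSup S₂ by linarith)
  set ψ₂' : GaugeConfig 3 L SU2 → ℝ := (Real.sqrt (l2 ψ₂ ψ₂))⁻¹ • ψ₂ with hψ₂'
  have h₂' : IsPhys ψ₂' := h₂.smul _
  have hP₂' : P ψ₂' := hPsmul _ _ hP₂
  have hn₂' : l2 ψ₂' ψ₂' = 1 := l2_normalise hn₂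
  have horth' : l2 ψ₁' ψ₂' = 0 := by
    rw [hψ₂', UpStep.l2_smul_right', l2_comm ψ₁' ψ₂, horth₂, mul_zero]
  have hq₂ : s - η ≤ qform su2Rep β ψ₂' ψ₂' := le_qform_normalise β h₂ hn₂ hR₂
  -- Rayleigh `≤ t` on the span
  set q₁₁ : ℝ := qform su2Rep β ψ₁' ψ₁' with hq₁₁def
  set q₂₂ : ℝ := qform su2Rep β ψ₂' ψ₂' with hq₂₂def
  set c : ℝ := qform su2Rep β ψ₁' ψ₂' with hcdef
  have hspan : ∀ a b : ℝ, a ^ 2 * q₁₁ + 2 * a * b * c + b ^ 2 * q₂₂ ≤ t * (a ^ 2 + b ^ 2) := by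
    intro a b
    rcases (eq_or_ne (a ^ 2 + b ^ 2) 0) with hab | hab
    · have ha2 : a ^ 2 = 0 := by linarith [sq_nonneg a, sq_nonneg b]
      have hb2 : b ^ 2 = 0 := by linarith [sq_nonneg a, sq_nonneg b]
      have ha : a = 0 := pow_eq_zero_iff (two_ne_zero) |>.mp ha2
      have hb : b = 0 := pow_eq_zero_iff (two_ne_zero) |>.mp hb2
      subst ha; subst hb
      simp
    · have habpos : 0 < a ^ 2 + b ^ 2 := lt_of_le_of_ne (by positivity) (Ne.symm hab)
      have hf : IsPhys (a • ψ₁' + b • ψ₂') := (h₁'.smul a).add (h₂'.smul b)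
      have hPf : P (a • ψ₁' + b • ψ₂') := hPadd _ _ (hPsmul _ _ hP₁') (hPsmul _ _ hP₂')
      have hnf : l2 (a • ψ₁' + b • ψ₂') (a • ψ₁' + b • ψ₂') = a ^ 2 + b ^ 2 :=
        l2_span_self h₁' h₂' hn₁' hn₂' horth' a b
      have hmem : qform su2Rep β (a • ψ₁' + b • ψ₂') (a • ψ₁' + b • ψ₂') / (a ^ 2 + b ^ 2) ∈ rayleighSet su2Rep L β P :=
        ⟨_, hf, hPf, by rw [hnf]; exact habpos, by rw [hnf]⟩
      have hle := le_csSup (bddAbove_rayleighSet_su2Rep L β P) hmem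
      rw [div_le_iff₀ habpos, qform_span_self β h₁' h₂'] at hle
      exact hle
  have hq₂₂0 : 0 ≤ q₂₂ := qform_su2Rep_self_nonneg hβ h₂'
  -- the cross term: `|c| ≤ κ₀ = √(ηt) ≤ δ/2`
  set κ₀ : ℝ := Real.sqrt (η * t) with hκ₀def
  set τ₀ : ℝ := Real.sqrt (η / t) with hτ₀def
  have hκ₀pos : 0 < κ₀ := Real.sqrt_pos.mpr (mul_pos hη ht)
  have hτ₀sq : τ₀ ^ 2 = η / t := Real.sq_sqrt (div_nonneg hη.le ht.le)
  have hτ₀t : τ₀ * t = κ₀ := by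
    have h1 : Real.sqrt (η / t * t ^ 2) = Real.sqrt (η / t) * Real.sqrt (t ^ 2) :=
      Real.sqrt_mul (div_nonneg hη.le ht.le) _
    have h2 : Real.sqrt (t ^ 2) = t := Real.sqrt_sq ht.le
    have h3 : η / t * t ^ 2 = η * t := by field_simp
    calc τ₀ * t = Real.sqrt (η / t) * Real.sqrt (t ^ 2) := by rw [h2]
      _ = Real.sqrt (η / t * t ^ 2) := h1.symm
      _ = κ₀ := by rw [h3]
  have hκ₀sq : κ₀ ^ 2 = η * t := Real.sq_sqrt (mul_nonneg hη.le ht.le)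
  have hηtt : η / t * t = η := div_mul_cancel₀ η ht.ne'
  have hcross : ∀ τ : ℝ, 2 * (τ * c) ≤ η + τ ^ 2 * t := by
    intro τ
    have h := hspan 1 τ
    have hτq : 0 ≤ τ ^ 2 * q₂₂ := mul_nonneg (sq_nonneg τ) hq₂₂0
    have he : (1 : ℝ) ^ 2 * q₁₁ + 2 * 1 * τ * c + τ ^ 2 * q₂₂ = q₁₁ + 2 * (τ * c) + τ ^ 2 * q₂₂ := by ring
    have he' : t * ((1 : ℝ) ^ 2 + τ ^ 2) = t + τ ^ 2 * t := by ring
    rw [he, he'] at h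
    linarith
  have hc_le : c ≤ κ₀ := by
    have h := hcross τ₀
    rw [hτ₀sq, hηtt] at h
    have h2 : τ₀ * c ≤ η := by linarith
    have h3 : κ₀ * c ≤ κ₀ * κ₀ := by
      have h4 := mul_le_mul_of_nonneg_right h2 ht.le
      calc κ₀ * c = τ₀ * c * t := by rw [← hτ₀t]; ring
        _ ≤ η * t := h4
        _ = κ₀ * κ₀ := by rw [← sq, hκ₀sq]
    exact le_of_mul_le_mul_left h3 hκ₀pos
  have hc_ge : -κ₀ ≤ c := by
    have h := hcross (-τ₀)
    rw [neg_sq, hτ₀sq, hηtt] at h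
    have h2 : τ₀ * (-c) ≤ η := by linarith
    have h3 : κ₀ * (-c) ≤ κ₀ * κ₀ := by
      have h4 := mul_le_mul_of_nonneg_right h2 ht.le
      calc κ₀ * (-c) = τ₀ * (-c) * t := by rw [← hτ₀t]; ring
        _ ≤ η * t := h4
        _ = κ₀ * κ₀ := by rw [← sq, hκ₀sq]
    have := le_of_mul_le_mul_left h3 hκ₀pos
    linarith
  have hκ₀δ : κ₀ ≤ δ / 2 := by
    rw [hκ₀def, show δ / 2 = Real.sqrt ((δ / 2) ^ 2) by rw [Real.sqrt_sq (by linarith)]]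
    exact Real.sqrt_le_sqrt (by nlinarith)
  -- the plane and its floor
  refine ⟨ψ₁', ψ₂', h₁', h₂', hP₁', hP₂', hn₁', hn₂', horth', fun a b => ?_⟩
  rw [qform_span_self β h₁' h₂']
  have hx1 : 0 ≤ (κ₀ - c) * (a - b) ^ 2 := mul_nonneg (sub_nonneg.2 hc_le) (sq_nonneg (a - b))
  have hx2 : 0 ≤ (κ₀ + c) * (a + b) ^ 2 := mul_nonneg (by linarith) (sq_nonneg (a + b))
  have hx : -((a ^ 2 + b ^ 2) * κ₀) ≤ 2 * a * b * c := by
    have he : (κ₀ - c) * (a - b) ^ 2 + (κ₀ + c) * (a + b) ^ 2 = 2 * ((a ^ 2 + b ^ 2) * κ₀ + 2 * a * b * c) := by ring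
    linarith [he ▸ add_nonneg hx1 hx2]
  have ha2 : a ^ 2 * (t - η) ≤ a ^ 2 * q₁₁ := mul_le_mul_of_nonneg_left hq₁ (sq_nonneg a)
  have hb2 : b ^ 2 * (s - η) ≤ b ^ 2 * q₂₂ := mul_le_mul_of_nonneg_left hq₂ (sq_nonneg b)
  have hta : a ^ 2 * (s - η) ≤ a ^ 2 * (t - η) := mul_le_mul_of_nonneg_left (by linarith) (sq_nonneg a)
  have hfin : (s - δ) * (a ^ 2 + b ^ 2) ≤ (s - η - κ₀) * (a ^ 2 + b ^ 2) :=
    mul_le_mul_of_nonneg_right (by linarith) (by positivity)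
  have hexp : (s - η - κ₀) * (a ^ 2 + b ^ 2) = a ^ 2 * (s - η) + b ^ 2 * (s - η) + -((a ^ 2 + b ^ 2) * κ₀) := by ring
  linarith [hexp]

/-! ## §2 ★ The `t`-half: `t (Q ∪ {p₀})` from one-plaquette rarity of near-optimal `Q`-walled trial functions -/

/-- ★ **(T)-door.**  `β > 0`, any real `κ`, any wall set `Q`, any plaquette `p₀`, `δ > 0`, `ε < 1` with `λ₀ε ≤ tQ − δ`.  If every physical `f`
admissible for `W Q` with `‖f‖² > 0` and Rayleigh quotient `≥ tQ − δ` has `‖1_{p₀ κ-bad} f‖² ≤ ε‖f‖²`, then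
`(√(tQ − δ) − √(λ₀ε))² ≤ t (Q ∪ {p₀})`. [cite: ReedSimonIV1978, Thm. XIII.1] -/
theorem le_walledTop_insert_of_rarity {β : ℝ} (hβ : 0 < β) (κ : ℝ) (Q : Set (Plaquette 3 L)) (p₀ : Plaquette 3 L)
    {δ ε : ℝ} (hδ : 0 < δ) (hε1 : ε < 1)
    (hεm : topValue su2Rep L β * ε ≤ sSup (rayleighSet su2Rep L β fun ψ => ∀ U : GaugeConfig 3 L SU2,
        (∃ p ∈ Q, β ^ (κ - 1) < 2 - (su2Rep (plaquetteHolonomy U p.1 p.2.1.1 p.2.1.2)).trace.re) → ψ U = 0) - δ)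
    (hR : ∀ f : GaugeConfig 3 L SU2 → ℝ, IsPhys f →
      (∀ U : GaugeConfig 3 L SU2,
        (∃ p ∈ Q, β ^ (κ - 1) < 2 - (su2Rep (plaquetteHolonomy U p.1 p.2.1.1 p.2.1.2)).trace.re) → f U = 0) →
      0 < l2 f f →
      (sSup (rayleighSet su2Rep L β fun ψ => ∀ U : GaugeConfig 3 L SU2,
        (∃ p ∈ Q, β ^ (κ - 1) < 2 - (su2Rep (plaquetteHolonomy U p.1 p.2.1.1 p.2.1.2)).trace.re) → ψ U = 0) - δ) * l2 f f ≤
        qform su2Rep β f f →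
      l2 ({U : GaugeConfig 3 L SU2 | β ^ (κ - 1) < 2 - (su2Rep (plaquetteHolonomy U p₀.1 p₀.2.1.1 p₀.2.1.2)).trace.re}.indicator f)
        ({U : GaugeConfig 3 L SU2 | β ^ (κ - 1) < 2 - (su2Rep (plaquetteHolonomy U p₀.1 p₀.2.1.1 p₀.2.1.2)).trace.re}.indicator f) ≤
        ε * l2 f f) :
    (Real.sqrt (sSup (rayleighSet su2Rep L β fun ψ => ∀ U : GaugeConfig 3 L SU2,
        (∃ p ∈ Q, β ^ (κ - 1) < 2 - (su2Rep (plaquetteHolonomy U p.1 p.2.1.1 p.2.1.2)).trace.re) → ψ U = 0) - δ) -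
      Real.sqrt (topValue su2Rep L β * ε)) ^ 2 ≤
      sSup (rayleighSet su2Rep L β fun ψ => ∀ U : GaugeConfig 3 L SU2,
        (∃ p ∈ insert p₀ Q, β ^ (κ - 1) < 2 - (su2Rep (plaquetteHolonomy U p.1 p.2.1.1 p.2.1.2)).trace.re) → ψ U = 0) := by
  have ht := walledTop_pos L hβ κ Q
  obtain ⟨f, hf, hWf, hfpos, hm⟩ := exists_witness_gt _ ht (show _ - δ < _ by linarith)
  have hcut := wall_compl_indicator_eq_of_admissible (β ^ (κ - 1)) Q p₀ hWf
  refine le_walledTop_of_cut hβ κ (insert p₀ Q) hf hfpos hm ?_ hε1 hεm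
  rw [hcut]
  exact hR f hf hWf hfpos hm

/-! ## §3 ★ The `s`-half: `s (Q ∪ {p₀})` from one-plaquette rarity of near-optimal `Q`-walled trial planes -/

/-- ★ **(S)-door.**  `β > 0`, any real `κ`, any wall set `Q`, any plaquette `p₀`, `δ > 0`, `ε < 1` with `λ₀ε ≤ sQ − δ`.  If every
`l2`-orthonormal physical pair `f₁, f₂` admissible for `W Q` whose span has Rayleigh floor `sQ − δ` satisfies, span-uniformly,
`‖1_{p₀ κ-bad}(af₁ + bf₂)‖² ≤ ε(a² + b²)`, then `(√(sQ − δ) − √(λ₀ε))² ≤ s (Q ∪ {p₀})` — no walled eigenfunctions needed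
(`exists_plane_of_compressedSecond`, `walledSecond_pos`). [cite: ReedSimonIV1978, Thm. XIII.1] -/
theorem le_walledSecond_insert_of_planeRarity {β : ℝ} (hβ : 0 < β) (κ : ℝ) (Q : Set (Plaquette 3 L)) (p₀ : Plaquette 3 L)
    {δ ε : ℝ} (hδ : 0 < δ) (hε1 : ε < 1)
    (hεm : topValue su2Rep L β * ε ≤ sInf {x : ℝ | ∃ φ : GaugeConfig 3 L SU2 → ℝ, IsPhys φ ∧
      x = sSup (rayleighSet su2Rep L β fun ψ => (∀ U : GaugeConfig 3 L SU2,
        (∃ p ∈ Q, β ^ (κ - 1) < 2 - (su2Rep (plaquetteHolonomy U p.1 p.2.1.1 p.2.1.2)).trace.re) → ψ U = 0) ∧ l2 ψ φ = 0)} - δ)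
    (hR : ∀ f₁ f₂ : GaugeConfig 3 L SU2 → ℝ, IsPhys f₁ → IsPhys f₂ →
      (∀ U : GaugeConfig 3 L SU2,
        (∃ p ∈ Q, β ^ (κ - 1) < 2 - (su2Rep (plaquetteHolonomy U p.1 p.2.1.1 p.2.1.2)).trace.re) → f₁ U = 0) →
      (∀ U : GaugeConfig 3 L SU2,
        (∃ p ∈ Q, β ^ (κ - 1) < 2 - (su2Rep (plaquetteHolonomy U p.1 p.2.1.1 p.2.1.2)).trace.re) → f₂ U = 0) →
      l2 f₁ f₁ = 1 → l2 f₂ f₂ = 1 → l2 f₁ f₂ = 0 →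
      (∀ a b : ℝ, (sInf {x : ℝ | ∃ φ : GaugeConfig 3 L SU2 → ℝ, IsPhys φ ∧
        x = sSup (rayleighSet su2Rep L β fun ψ => (∀ U : GaugeConfig 3 L SU2,
          (∃ p ∈ Q, β ^ (κ - 1) < 2 - (su2Rep (plaquetteHolonomy U p.1 p.2.1.1 p.2.1.2)).trace.re) → ψ U = 0) ∧ l2 ψ φ = 0)} - δ) *
          (a ^ 2 + b ^ 2) ≤ qform su2Rep β (a • f₁ + b • f₂) (a • f₁ + b • f₂)) →
      ∀ a b : ℝ,
        l2 ({U : GaugeConfig 3 L SU2 | β ^ (κ - 1) < 2 - (su2Rep (plaquetteHolonomy U p₀.1 p₀.2.1.1 p₀.2.1.2)).trace.re}.indicator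
            (a • f₁ + b • f₂))
          ({U : GaugeConfig 3 L SU2 | β ^ (κ - 1) < 2 - (su2Rep (plaquetteHolonomy U p₀.1 p₀.2.1.1 p₀.2.1.2)).trace.re}.indicator
            (a • f₁ + b • f₂)) ≤ ε * (a ^ 2 + b ^ 2)) :
    (Real.sqrt (sInf {x : ℝ | ∃ φ : GaugeConfig 3 L SU2 → ℝ, IsPhys φ ∧
        x = sSup (rayleighSet su2Rep L β fun ψ => (∀ U : GaugeConfig 3 L SU2,
          (∃ p ∈ Q, β ^ (κ - 1) < 2 - (su2Rep (plaquetteHolonomy U p.1 p.2.1.1 p.2.1.2)).trace.re) → ψ U = 0) ∧ l2 ψ φ = 0)} - δ) -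
      Real.sqrt (topValue su2Rep L β * ε)) ^ 2 ≤
      sInf {x : ℝ | ∃ φ : GaugeConfig 3 L SU2 → ℝ, IsPhys φ ∧ x = sSup (rayleighSet su2Rep L β fun ψ =>
        (∀ U : GaugeConfig 3 L SU2,
          (∃ p ∈ insert p₀ Q, β ^ (κ - 1) < 2 - (su2Rep (plaquetteHolonomy U p.1 p.2.1.1 p.2.1.2)).trace.re) → ψ U = 0) ∧
        l2 ψ φ = 0)} := by
  have hs := walledSecond_pos L hβ κ Q
  -- the wall constraint is linear
  have hPadd : ∀ f g : GaugeConfig 3 L SU2 → ℝ,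
      (∀ U : GaugeConfig 3 L SU2,
        (∃ p ∈ Q, β ^ (κ - 1) < 2 - (su2Rep (plaquetteHolonomy U p.1 p.2.1.1 p.2.1.2)).trace.re) → f U = 0) →
      (∀ U : GaugeConfig 3 L SU2,
        (∃ p ∈ Q, β ^ (κ - 1) < 2 - (su2Rep (plaquetteHolonomy U p.1 p.2.1.1 p.2.1.2)).trace.re) → g U = 0) →
      ∀ U : GaugeConfig 3 L SU2,
        (∃ p ∈ Q, β ^ (κ - 1) < 2 - (su2Rep (plaquetteHolonomy U p.1 p.2.1.1 p.2.1.2)).trace.re) → (f + g) U = 0 :=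
    fun f g hf hg U hU => by rw [Pi.add_apply, hf U hU, hg U hU, add_zero]
  have hPsmul : ∀ (a : ℝ) (f : GaugeConfig 3 L SU2 → ℝ),
      (∀ U : GaugeConfig 3 L SU2,
        (∃ p ∈ Q, β ^ (κ - 1) < 2 - (su2Rep (plaquetteHolonomy U p.1 p.2.1.1 p.2.1.2)).trace.re) → f U = 0) →
      ∀ U : GaugeConfig 3 L SU2,
        (∃ p ∈ Q, β ^ (κ - 1) < 2 - (su2Rep (plaquetteHolonomy U p.1 p.2.1.1 p.2.1.2)).trace.re) → (a • f) U = 0 :=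
    fun a f hf U hU => by rw [Pi.smul_apply, hf U hU, smul_zero]
  obtain ⟨f₁, f₂, h₁, h₂, hW₁, hW₂, hn₁, hn₂, horth, hfloor⟩ := exists_plane_of_compressedSecond hβ.le hPadd hPsmul hs hδ
  refine le_walledSecond_of_cut_pair hβ κ (insert p₀ Q) h₁ h₂ hn₁ hn₂ horth hfloor ?_ hε1 hεm
  intro a b
  have hWab := hPadd _ _ (hPsmul a f₁ hW₁) (hPsmul b f₂ hW₂)
  rw [wall_compl_indicator_eq_of_admissible (β ^ (κ - 1)) Q p₀ hWab]
  exact hR f₁ f₂ h₁ h₂ hW₁ hW₂ hn₁ hn₂ horth hfloor a b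

end Summit.QuantumFields.YangMills.Theorems.FemtoTransferGap.SFCompression

end
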